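import Literature.AnabelianGeometry.EtaleTheta.SettingModelKrullZNStandardSplitting
import Literature.AnabelianGeometry.EtaleTheta.SettingModelChiZNAllSplittings
import Literature.AnabelianGeometry.EtaleTheta.SettingModelKrullNotTateOrigin
import Literature.AnabelianGeometry.EtaleTheta.Discharge.Sec1ZNSplittingOfCuspSection
import Literature.AnabelianGeometry.EtaleTheta.ThetaSettingTopology
import HarnessLib

/-!
# The cusped KRULL model `modelκ′`: the origin clause `GtpZNFromSplitting` for ALL lifted splittings, and the
# `IsThm16Origin`-side of the K3 origin-inputs census WITH the `Z_N` clause (κ′-twin of `SettingModelChiZNAllSplittings`)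

Mochizuki, *The étale theta function and its Frobenioid-theoretic manifestations*, Publ. RIMS **45** (2009) [EtTh],
§1 p. 14 («[by the definition of `J_N`] … all splittings … determine the same splitting over `G_{J_N}`»)
[cite: MochizukiEtTh2009, §1 p.14].

abc-iut cell, layer L2, seat abc-iut-L2-t1 (§1 ROOT owner, gen 7; row 4, file B). PROOF-ONLY. At abc-iut-L2-t10's
`ThetaSetting.modelκ' p` (`Π^tp_X = Γ ⋊_{θ∘1} G_{ℚ_p}`, the Galois action on `Γ` TRIVIAL: `actκ_apply_eq`) the three-step
argument of abc-iut-w5-d062's `SettingModelChiZNAllSplittings` (p458978) ports with the twist step replaced by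
`actκ_apply_eq`: the level character `σ ↦ ĥ_N(γ_σ).z` of a lifted splitting is a homomorphism `G_{K_N} → ℤ/N`
(`levelHom_left_z_mul_of_splitting_κ'`), it kills `G_{J_N}` granted strong completeness of `G_{ℚ_p}` and Kummer
containment (w5-d062's `apply_eq_one_of_mem_GJN_of_stronglyComplete` BY NAME), and file A's clause for the standard
splitting transfers:
* **`gtpZNFromSplitting_modelκ'_of_stronglyComplete (hsc) : (modelκ' p).GtpZNFromSplitting N`** (every `N`);
* `hasThetaTopology_modelκ` / `hasThetaTopology_modelκ'` — abc-iut-L2-t1's root predicate `HasThetaTopology` (R3 +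
  «`(Δ^tp_Y)^Θ` compact») HOLDS at both Krull models, by its constructor `of_hYcl` from abc-iut-L2-t10's `hYcl_modelκ`,
  the quotient-map clauses and the group-level bundle (`nonempty_groupLevelData_curveκ` / `_curveκ'`) — the census item
  «`HasThetaTopology` at `modelκ′`» left open in `SettingModelThm16iiiOriginInputsCensus` (p466165);
* **`modelκ'_thm16iiiOriginInputs_v2 (hsc)`** / **`exists_isThm16Origin_gtpZNFromSplitting (hsc)`** — the
  `IsThm16Origin`-side of the K3 origin-inputs census now WITH the `Z_N` clause AND `HasThetaTopology`: at ONE setting,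
  guard ∧ `IsThm16Origin` ∧ `CuspLaws` ∧ `HasThetaTopology` ∧ a cusp section ∧ lifted splittings ∀N ∧
  `GtpZNFromSplitting` ∀N (mod `hsc`) ∧ `¬ IsTateOrigin` — the first joint witness of `IsThm16Origin ∧ GtpZNFromSplitting`;
  so, modulo strong completeness of `G_{ℚ_p}` (unconditional Summits-side, p461655), EVERY setting-level input of the
  K3 end-knit v5 `Thm16Sub.thm16iii_of_origins` (p462527) except `IsTateOrigin` (⇔ `GKNIsKernelOfAction` ∀N here) is
  jointly inhabited on the `IsThm16Origin` side, and everything except the cusp clause on the `IsTateOrigin` side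
  (`modelχq`, p463822/p466165).
SEMI-SYNTHETIC MODEL (the Galois action on `Γ` is trivial; consistency evidence only); nothing of [EtTh] asserted; no side
taken on [IUTchIII] Cor. 3.12; typed ≠ proved.
-/

noncomputable section

namespace Literature.AnabelianGeometry.EtaleTheta.SettingModel

open Literature.AnabelianGeometry.SemiGraphs _root_.Function _root_.Topology Thm16Sub

variable (p : ℕ) [Fact p.Prime] (N : ℕ+)

/-! ### Bookkeeping in `Γ ⋊_{θ∘1} G_{ℚ_p}` -/

/-- In `Γ ⋊_{θ∘1} G`: two elements with the same `G`-component differ by `inl` of the quotient of their `Γ`-components.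
[cite: MochizukiEtTh2009, §1 p.12] -/
theorem mul_inv_eq_inl_of_right_eq_κ' {g h : PiTpκ p} (hr : g.right = h.right) :
    g * h⁻¹ = SemidirectProduct.inl (g.left * h.left⁻¹) := by
  refine SemidirectProduct.ext ?_ ?_
  · rw [SemidirectProduct.mul_left, SemidirectProduct.inv_left, SemidirectProduct.left_inl, ← MulAut.mul_apply,
      ← map_mul, hr, mul_inv_cancel, map_one, MulAut.one_apply]
  · rw [SemidirectProduct.mul_right, SemidirectProduct.inv_right, SemidirectProduct.right_inl, hr, mul_inv_cancel]

/-- An element of `Π^tp_{Y_N}` of `modelκ′` has `Γ`-component in `Δ^tp_{Y_N} ⊆ Ker pr₂` and `G`-component in `G_{K_N}`.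
[cite: MochizukiEtTh2009, §1 p.13] -/
theorem left_mem_dY_of_mem_YNκ' {g : PiTpκ p} (hg : g ∈ YNκ p N) :
    g.left ∈ dY N ∧ g.left ∈ gfpSnd.ker ∧ g.right ∈ (fieldKN ⊥ (qModel p) N).fixingSubgroup := by
  obtain ⟨hl, hr⟩ := (GfpTwistData.mem_YN (krullTwistData p)).mp hg
  exact ⟨hl, dY_le N hl, hr⟩

/-! ### (1) The level character of a lifted splitting (κ′) -/

section Splitting

variable {p N}
variable {g : ↥((ThetaSetting.modelκ' p).GKN N) → PiTpκ p}

/-- **The level character is multiplicative (κ′).** With the TRIVIAL action on `Γ` the `Γ`-components of the lifts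
multiply on the nose modulo `Δ^tp_{Z_N}`: `ĥ_N(γ_{στ}) = ĥ_N(γ_σ)·ĥ_N(γ_τ)`. [cite: MochizukiEtTh2009, §1 p.14] -/
theorem levelHom_left_mul_of_splitting_κ'
    (hgY : ∀ σ, g σ ∈ YNκ p N) (hgr : ∀ σ, (g σ).right = (σ : GQp p))
    (hmul : ∀ σ τ, CurveTheta.toTheta (curveκ' p) (g (σ * τ)) *
      (CurveTheta.toTheta (curveκ' p) (g σ) * CurveTheta.toTheta (curveκ' p) (g τ))⁻¹ ∈
        (ThetaSetting.modelκ' p).thetaPowersY N)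
    (σ τ : ↥((ThetaSetting.modelκ' p).GKN N)) :
    levelHom N (g (σ * τ)).left = levelHom N (g σ).left * levelHom N (g τ).left := by
  have h := hmul σ τ
  rw [← map_mul, ← map_inv, ← map_mul] at h
  have hright : (g (σ * τ)).right = (g σ * g τ).right := by
    rw [SemidirectProduct.mul_right, hgr, hgr, hgr, Subgroup.coe_mul]
  rw [mul_inv_eq_inl_of_right_eq_κ' p hright] at h
  have hker₁ : (g (σ * τ)).left ∈ gfpSnd.ker := (left_mem_dY_of_mem_YNκ' p N (hgY _)).2.1
  have hkerσ : (g σ).left ∈ gfpSnd.ker := (left_mem_dY_of_mem_YNκ' p N (hgY _)).2.1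
  have hkerτ : (g τ).left ∈ gfpSnd.ker := (left_mem_dY_of_mem_YNκ' p N (hgY _)).2.1
  have hker₂ : (g σ * g τ).left ∈ gfpSnd.ker := by
    rw [SemidirectProduct.mul_left, actκ_apply_eq]
    exact mul_mem hkerσ hkerτ
  have hmem : (g (σ * τ)).left * (g σ * g τ).left⁻¹ ∈ gfpSnd.ker := mul_mem hker₁ (inv_mem hker₂)
  rw [toThetaκ'_inl_mem_thetaPowersY_iff p N hmem, map_mul, map_inv, mul_inv_eq_one] at h
  rw [h, SemidirectProduct.mul_left, actκ_apply_eq, map_mul]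

/-- The `z`-coordinates of the level shadows ADD (κ′): `σ ↦ ĥ_N(γ_σ).z` is a homomorphism `G_{K_N} → ℤ/N`.
[cite: MochizukiEtTh2009, §1 p.14] -/
theorem levelHom_left_z_mul_of_splitting_κ'
    (hgY : ∀ σ, g σ ∈ YNκ p N) (hgr : ∀ σ, (g σ).right = (σ : GQp p))
    (hmul : ∀ σ τ, CurveTheta.toTheta (curveκ' p) (g (σ * τ)) *
      (CurveTheta.toTheta (curveκ' p) (g σ) * CurveTheta.toTheta (curveκ' p) (g τ))⁻¹ ∈
        (ThetaSetting.modelκ' p).thetaPowersY N)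
    (σ τ : ↥((ThetaSetting.modelκ' p).GKN N)) :
    (levelHom N (g (σ * τ)).left).z = (levelHom N (g σ).left).z + (levelHom N (g τ).left).z := by
  rw [levelHom_left_mul_of_splitting_κ' hgY hgr hmul σ τ, Heis.mul_z,
    (levelHom_mem_zAxis_of_mem_dY N (left_mem_dY_of_mem_YNκ' p N (hgY σ)).1).1, zero_mul, add_zero]

end Splitting

/-! ### The origin clause for `Z_N` at `modelκ′`, for ALL splittings -/

/-- **`GtpZNFromSplitting (modelκ' p) N` for EVERY lifted splitting, granted strong completeness of `G_{ℚ_p}`** (κ′-twin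
of w5-d062's `gtpZNFromSplitting_modelχ_of_stronglyComplete`): the level character of a lifted splitting kills `G_{J_N}`
(`apply_eq_one_of_mem_GJN_of_stronglyComplete`), so the splitting agrees with `θ ∘ inr` on `G_{J_N}` modulo
`N·(Δ^tp_Y)^Θ`, and file A's `toThetaκ'_inl_mem_thetaPowersY_iff` gives the clause. [cite: MochizukiEtTh2009, §1 p.14] -/
theorem gtpZNFromSplitting_modelκ'_of_stronglyComplete
    (hsc : ∀ U : Subgroup (GQp p), U.FiniteIndex → IsOpen (U : Set (GQp p))) :
    (ThetaSetting.modelκ' p).GtpZNFromSplitting N := by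
  intro s hs g
  choose lift hliftY hliftaug hliftθ using hs.exists_lift
  have hliftr : ∀ σ, (lift σ).right = (σ : GQp p) := fun σ => hliftaug σ
  have hmul : ∀ σ τ, CurveTheta.toTheta (curveκ' p) (lift (σ * τ)) *
      (CurveTheta.toTheta (curveκ' p) (lift σ) * CurveTheta.toTheta (curveκ' p) (lift τ))⁻¹ ∈
        (ThetaSetting.modelκ' p).thetaPowersY N := by
    intro σ τ
    have h := hs.map_mul_mem σ τ
    rw [← hliftθ, ← hliftθ, ← hliftθ] at h
    exact h
  -- the level character `f : G_{K_N} → ℤ/N`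
  let f : ↥((fieldKN ⊥ (qModel p) N).fixingSubgroup) →* Multiplicative (ZMod N) :=
    MonoidHom.mk' (fun σ => Multiplicative.ofAdd (levelHom N (lift σ).left).z) fun σ τ => by
      rw [← ofAdd_add]
      exact congrArg Multiplicative.ofAdd (levelHom_left_z_mul_of_splitting_κ' hliftY hliftr hmul σ τ)
  -- it kills `G_{J_N}`
  have hJ : ∀ (σ : GQp p) (hσ : σ ∈ (fieldJN ⊥ (qModel p) N).fixingSubgroup),
      levelHom N (lift ⟨σ, (ThetaSetting.modelκ' p).GJN_le_GKN N hσ⟩).left = 1 := by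
    intro σ hσ
    obtain ⟨h, h1⟩ := apply_eq_one_of_mem_GJN_of_stronglyComplete p N hsc f hσ
    have hz : (levelHom N (lift ⟨σ, (ThetaSetting.modelκ' p).GJN_le_GKN N hσ⟩).left).z = 0 :=
      ofAdd_eq_one.mp h1
    exact (levelHom_eq_one_iff_z_eq_zero (left_mem_dY_of_mem_YNκ' p N (hliftY _)).1).mpr hz
  constructor
  · intro hZ
    obtain ⟨hl, hr⟩ := (GfpTwistData.mem_ZN (krullTwistData p)).mp hZ
    have hY : g ∈ (ThetaSetting.modelκ' p).GtpYN N :=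
      (GfpTwistData.mem_YN (krullTwistData p)).mpr ⟨dZ_le_dY N hl, (ThetaSetting.modelκ' p).GJN_le_GKN N hr⟩
    refine ⟨hY, hr, ?_⟩
    set σ' : ↥((ThetaSetting.modelκ' p).GKN N) :=
      ⟨(ThetaSetting.modelκ' p).aug g, (ThetaSetting.modelκ' p).GJN_le_GKN N hr⟩
    rw [← hliftθ σ']
    change CurveTheta.toTheta (curveκ' p) g * (CurveTheta.toTheta (curveκ' p) (lift σ'))⁻¹ ∈ _
    have hright : g.right = (lift σ').right := by rw [hliftr]; rfl
    have hJ' : levelHom N (lift σ').left = 1 := hJ _ hr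
    rw [← map_inv, ← map_mul, mul_inv_eq_inl_of_right_eq_κ' p hright,
      toThetaκ'_inl_mem_thetaPowersY_iff p N
        (mul_mem (Subgroup.mem_inf.mp hl).1 (inv_mem (left_mem_dY_of_mem_YNκ' p N (hliftY σ')).2.1)),
      map_mul, map_inv, hJ', inv_one, mul_one]
    exact (Subgroup.mem_inf.mp hl).2
  · rintro ⟨hY, hr, hmem⟩
    obtain ⟨hl, -⟩ := (GfpTwistData.mem_YN (krullTwistData p)).mp hY
    have hs' : g.left ∈ gfpSnd.ker := (Subgroup.mem_inf.mp hl).1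
    set σ' : ↥((ThetaSetting.modelκ' p).GKN N) :=
      ⟨(ThetaSetting.modelκ' p).aug g, (ThetaSetting.modelκ' p).GJN_le_GKN N hr⟩
    rw [← hliftθ σ'] at hmem
    change CurveTheta.toTheta (curveκ' p) g * (CurveTheta.toTheta (curveκ' p) (lift σ'))⁻¹ ∈ _ at hmem
    have hright : g.right = (lift σ').right := by rw [hliftr]; rfl
    have hJ' : levelHom N (lift σ').left = 1 := hJ _ hr
    rw [← map_inv, ← map_mul, mul_inv_eq_inl_of_right_eq_κ' p hright,
      toThetaκ'_inl_mem_thetaPowersY_iff p N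
        (mul_mem hs' (inv_mem (left_mem_dY_of_mem_YNκ' p N (hliftY σ')).2.1)),
      map_mul, map_inv, hJ', inv_one, mul_one] at hmem
    exact (GfpTwistData.mem_ZN (krullTwistData p)).mpr ⟨Subgroup.mem_inf.mpr ⟨hs', hmem⟩, hr⟩

/-- The same from topological finite generation of `G_{ℚ_p}` (w5-d062's `stronglyComplete_GQp_of_tfg`).
[cite: MochizukiEtTh2009, §1 p.14] [cite: NikolovSegal2003, Thm 1.1] -/
theorem gtpZNFromSplitting_modelκ'
    (hG : AbsoluteAnabelian.IsTopologicallyFinitelyGenerated (Field.absoluteGaloisGroup ℚ_[p])) (N : ℕ+) :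
    (ThetaSetting.modelκ' p).GtpZNFromSplitting N :=
  gtpZNFromSplitting_modelκ'_of_stronglyComplete p N (stronglyComplete_GQp_of_tfg p hG)

/-! ### `HasThetaTopology` at the Krull models -/

/-- **`HasThetaTopology` HOLDS at the κ-model** (R3 + «`(Δ^tp_Y)^Θ` compact»): abc-iut-L2-t1's constructor `of_hYcl` from
the group-level bundle, the two quotient-map clauses and abc-iut-L2-t10's `hYcl_modelκ`. [cite: MochizukiEtTh2009, §1 p.12] -/
theorem hasThetaTopology_modelκ : (ThetaSetting.modelκ p).HasThetaTopology :=
  ThetaSetting.HasThetaTopology.of_hYcl (nonempty_groupLevelData_curveκ p).some (isQuotientMap_toTheta_modelκ p)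
    (isQuotientMap_thetaToEll_modelκ p) (hYcl_modelκ p)

/-- `hYcl` at `modelκ′` (same groups as `modelκ`). [cite: MochizukiEtTh2009, §1 p.12] -/
theorem hYcl_modelκ' :
    ((ThetaSetting.modelκ' p).DtpY.map (ThetaSetting.modelκ' p).toHat.toMonoidHom).topologicalClosure ≤
      (ThetaSetting.modelκ' p).DtpY.map (ThetaSetting.modelκ' p).toHat.toMonoidHom ⊔
        (⁅⁅(ThetaSetting.modelκ' p).DeltaHat, (ThetaSetting.modelκ' p).DeltaHat⁆,
          (ThetaSetting.modelκ' p).DeltaHat⁆).topologicalClosure :=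
  hYcl_modelκ p

/-- **`HasThetaTopology` HOLDS at the cusped Krull model `modelκ′`** — closes the census item left open in
`SettingModelThm16iiiOriginInputsCensus`. [cite: MochizukiEtTh2009, §1 p.12] -/
theorem hasThetaTopology_modelκ' : (ThetaSetting.modelκ' p).HasThetaTopology :=
  ThetaSetting.HasThetaTopology.of_hYcl (nonempty_groupLevelData_curveκ' p).some (isQuotientMap_toTheta_modelκ' p)
    (isQuotientMap_thetaToEll_modelκ' p) (hYcl_modelκ' p)

/-! ### The `IsThm16Origin`-side of the K3 origin-inputs census, now WITH the `Z_N` clause and `HasThetaTopology` -/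

/-- **The setting-level covering inputs of the K3 end-knit v5 at `modelκ′`, v2** (granted strong completeness of `G_{ℚ_p}`):
guard ∧ `IsThm16Origin` ∧ `CuspLaws` ∧ `HasThetaTopology` ∧ a cusp SECTION package in the knit's shape ∧ lifted
splittings ∀N ∧ **`GtpZNFromSplitting` ∀N** ∧ `GKNIsKernelOfAction 2` — and `¬ IsTateOrigin`. [cite: MochizukiEtTh2009, §1 p.14] -/
theorem modelκ'_thm16iiiOriginInputs_v2 (hsc : ∀ U : Subgroup (GQp p), U.FiniteIndex → IsOpen (U : Set (GQp p))) :
    (ThetaSetting.modelκ' p).IsEtThOrigin ∧ (ThetaSetting.modelκ' p).IsThm16Origin ∧ (ThetaSetting.modelκ' p).CuspLaws ∧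
      (ThetaSetting.modelκ' p).HasThetaTopology ∧
      (∃ (Dc : Subgroup (ThetaSetting.modelκ' p).PiTemp) (s : GQp p →* (ThetaSetting.modelκ' p).PiTemp),
        (ThetaSetting.modelκ' p).IsCuspidalDecompositionGroup Dc ∧ Dc ≤ (ThetaSetting.modelκ' p).GtpY ∧
          (∀ g : GQp p, g ∈ (ThetaSetting.modelκ' p).GK → (ThetaSetting.modelκ' p).aug (s g) = g) ∧
          (ThetaSetting.modelκ' p).GK.map s ≤ Dc) ∧
      (∀ N : ℕ+, ∃ t, (ThetaSetting.modelκ' p).IsThetaSplittingAt N t) ∧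
      (∀ N : ℕ+, (ThetaSetting.modelκ' p).GtpZNFromSplitting N) ∧
      GKNIsKernelOfAction (ThetaSetting.modelκ' p) 2 ∧
      ¬ (ThetaSetting.modelκ' p).IsTateOrigin := by
  have hDc : (ThetaSetting.modelκ' p).IsCuspidalDecompositionGroup (cuspDecompκ p) := ⟨(), trivial, 1, by rw [one_smul]⟩
  have hDcY : cuspDecompκ p ≤ (ThetaSetting.modelκ' p).GtpY := cuspidal_le_GtpY_modelκ' p hDc
  have hsec : ∀ g : GQp p, g ∈ (ThetaSetting.modelκ' p).GK →
      (ThetaSetting.modelκ' p).aug ((SemidirectProduct.inr : GQp p →* PiTpκ p) g) = g := fun g _ => rfl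
  have hsD : (ThetaSetting.modelκ' p).GK.map (SemidirectProduct.inr : GQp p →* PiTpκ p) ≤ cuspDecompκ p := by
    rintro _ ⟨g, -, rfl⟩
    change (SemidirectProduct.inr g : PiTpκ p) ∈ cuspDecompκ p
    rw [mem_cuspDecompκ_iff, SemidirectProduct.left_inr]
    exact Subgroup.one_mem _
  exact ⟨ThetaSetting.modelκ'_isEtThOrigin p, ThetaSetting.modelκ'_isThm16Origin p, cuspLaws_modelκ' p,
    hasThetaTopology_modelκ' p, ⟨_, _, hDc, hDcY, hsec, hsD⟩,
    fun N => exists_thetaSplittingAt_of_cuspSection (ThetaSetting.modelκ' p) hDc hDcY _ hsec hsD N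
      ((ThetaSetting.modelκ'_isThm16Origin p).gtpYN_fromCusp N),
    fun N => gtpZNFromSplitting_modelκ'_of_stronglyComplete p N hsc,
    (ThetaSetting.modelκ'_isThm16Origin p).gknIsKernelOfAction_two, modelκ'_not_isTateOrigin p⟩

/-- **Joint NV: `IsThm16Origin ∧ GtpZNFromSplitting`** (granted strong completeness of `G_{ℚ_p}`): SOME theta setting is
of [EtTh] origin, satisfies the origin clauses `IsThm16Origin`, the cusp laws AND `HasThetaTopology`, carries a Galois
section into a cuspidal decomposition group inside `Π^tp_Y`, and satisfies `GtpZNFromSplitting` at every level — `modelκ′`.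
[cite: MochizukiEtTh2009, §1 p.14] -/
theorem exists_isThm16Origin_gtpZNFromSplitting
    (hsc : ∀ U : Subgroup (GQp p), U.FiniteIndex → IsOpen (U : Set (GQp p))) :
    ∃ D : ThetaSetting p, D.IsEtThOrigin ∧ D.IsThm16Origin ∧ D.CuspLaws ∧ D.HasThetaTopology ∧
      (∃ (Dc : Subgroup D.PiTemp) (s : GQp p →* D.PiTemp), D.IsCuspidalDecompositionGroup Dc ∧ Dc ≤ D.GtpY ∧
        (∀ g : GQp p, g ∈ D.GK → D.aug (s g) = g) ∧ D.GK.map s ≤ Dc) ∧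
      (∀ N : ℕ+, ∃ t, D.IsThetaSplittingAt N t) ∧ (∀ N : ℕ+, D.GtpZNFromSplitting N) ∧ ¬ D.IsTateOrigin := by
  obtain ⟨h0, h16, hL, hTop, hcusp, hs, hZ, -, hT⟩ := modelκ'_thm16iiiOriginInputs_v2 p hsc
  exact ⟨ThetaSetting.modelκ' p, h0, h16, hL, hTop, hcusp, hs, hZ, hT⟩

end Literature.AnabelianGeometry.EtaleTheta.SettingModel

end
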